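import Summits.KontsevichZagierPeriods.KontsevichZagierPeriods.Theorems.UnfoldedStokesStokesGenerationFibrewiseRungDlogSector
import Literature.NumberTheory.Transcendental.KZSemialgebraicComplex
import Mathlib.MeasureTheory.Constructions.Pi
import Mathlib.Algebra.Polynomial.Derivative
import Mathlib.Algebra.Order.Floor.Defs

/-!
# `StokesGeneration` (stmt-KontsevichZagierPeriods-3586), line `fibrewise_stokes` — rung 4 (full angular sector): algebraic helpers

Helpers for the assembly `fibrewiseStokesGeneration_angularSector` of rung 4 of the line `fibrewise_stokes`
(the residual S2 on the FULL angular sector `γ·Im(P′/P)`, `P = A + iB` a complex polynomial loop with real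
algebraic coefficients and no zeros on `[0,1]`, root-free): re-centring the loop on a piece,
`P·conj P(zₖ) = Uₖ + iWₖ` with `Uₖ = aA + bB`, `Wₖ = aB − bA` (`a = A(zₖ)`, `b = B(zₖ)`), does not change the angular
derivative (`recentre_angular`: `(U W′ − U′ W)/(U² + W²) = (A B′ − A′ B)/(A² + B²)`), keeps algebraic
coefficients, and the boundary leftover of the clamped certificate is a half-angle kernel
(`leftover_eq_halfAngle`); the rational grid is algebraic and null, and a point off the grid lies in exactly one
open piece (`exists_unique_piece`). Pure algebra / bookkeeping; no definitions.

References: M. Kontsevich, D. Zagier, *Periods* (2001), §1.2; J. Ayoub, Ann. of Math. 181 (2015), Rem. 1.5.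
-/

noncomputable section

set_option linter.dupNamespace false

namespace Summit.KontsevichZagierPeriods.KontsevichZagierPeriods.Cruxes.StokesGeneration.FibrewiseStokes

open MeasureTheory Set
open Literature.NumberTheory.Transcendental
open Literature.NumberTheory.Transcendental.KZ
open Literature.ModelTheory.ExponentialFields (IsSemialgebraic)

/-! ## Rung 4 assembly helpers -/

/-- Rational grid points are real algebraic. [folklore] -/
theorem isAlgebraic_natCast_div (k N : ℕ) : IsAlgebraic ℚ ((k : ℝ) / N) := by
  have h := isAlgebraic_algebraMap (R := ℚ) (A := ℝ) ((k : ℚ) / N)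
  simpa using h

/-- Evaluation of the re-centred polynomial `a·A + b·B`. [folklore] -/
theorem recentre_eval (A B : Polynomial ℝ) (a b u : ℝ) :
    (Polynomial.C a * A + Polynomial.C b * B).eval u = a * A.eval u + b * B.eval u := by
  simp [Polynomial.eval_add, Polynomial.eval_mul, Polynomial.eval_C]

/-- Evaluation of the re-centred polynomial `a·B − b·A`. [folklore] -/
theorem recentre_eval' (A B : Polynomial ℝ) (a b u : ℝ) :
    (Polynomial.C a * B - Polynomial.C b * A).eval u = a * B.eval u - b * A.eval u := by
  simp [Polynomial.eval_sub, Polynomial.eval_mul, Polynomial.eval_C]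

/-- Derivative of the re-centred polynomial `a·A + b·B`. [folklore] -/
theorem recentre_derivative (A B : Polynomial ℝ) (a b : ℝ) :
    Polynomial.derivative (Polynomial.C a * A + Polynomial.C b * B) =
      Polynomial.C a * Polynomial.derivative A + Polynomial.C b * Polynomial.derivative B := by
  simp

/-- Derivative of the re-centred polynomial `a·B − b·A`. [folklore] -/
theorem recentre_derivative' (A B : Polynomial ℝ) (a b : ℝ) :
    Polynomial.derivative (Polynomial.C a * B - Polynomial.C b * A) =
      Polynomial.C a * Polynomial.derivative B - Polynomial.C b * Polynomial.derivative A := by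
  simp

/-- Coefficients of `a·A + b·B` are algebraic when `a`, `b` and the coefficients of `A`, `B` are. [folklore] -/
theorem recentre_coeff_isAlgebraic {A B : Polynomial ℝ} {a b : ℝ} (ha : IsAlgebraic ℚ a) (hb : IsAlgebraic ℚ b)
    (hA : ∀ n, IsAlgebraic ℚ (A.coeff n)) (hB : ∀ n, IsAlgebraic ℚ (B.coeff n)) (n : ℕ) :
    IsAlgebraic ℚ ((Polynomial.C a * A + Polynomial.C b * B).coeff n) := by
  rw [Polynomial.coeff_add, Polynomial.coeff_C_mul, Polynomial.coeff_C_mul]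
  exact mem_algebraicClosure_iff.mp (add_mem
    (mul_mem (mem_algebraicClosure_iff.mpr ha) (mem_algebraicClosure_iff.mpr (hA n)))
    (mul_mem (mem_algebraicClosure_iff.mpr hb) (mem_algebraicClosure_iff.mpr (hB n))))

/-- Coefficients of `a·B − b·A` are algebraic when `a`, `b` and the coefficients of `A`, `B` are. [folklore] -/
theorem recentre_coeff_isAlgebraic' {A B : Polynomial ℝ} {a b : ℝ} (ha : IsAlgebraic ℚ a) (hb : IsAlgebraic ℚ b)
    (hA : ∀ n, IsAlgebraic ℚ (A.coeff n)) (hB : ∀ n, IsAlgebraic ℚ (B.coeff n)) (n : ℕ) :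
    IsAlgebraic ℚ ((Polynomial.C a * B - Polynomial.C b * A).coeff n) := by
  rw [Polynomial.coeff_sub, Polynomial.coeff_C_mul, Polynomial.coeff_C_mul]
  exact mem_algebraicClosure_iff.mp (sub_mem
    (mul_mem (mem_algebraicClosure_iff.mpr ha) (mem_algebraicClosure_iff.mpr (hB n)))
    (mul_mem (mem_algebraicClosure_iff.mpr hb) (mem_algebraicClosure_iff.mpr (hA n))))

/-- **Re-centring does not change the angular derivative**: for `U + iW = (A + iB)(a − ib)`,
`Im(U′ + iW′)/(U + iW) = Im(A′ + iB′)/(A + iB)`, i.e.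
`(U W′ − U′ W)/(U² + W²) = (A B′ − A′ B)/(A² + B²)` when `a² + b² ≠ 0`. [folklore] -/
theorem recentre_angular : ∀ (A B : Polynomial ℝ) (a b u : ℝ), a ^ 2 + b ^ 2 ≠ 0 → A.eval u ^ 2 + B.eval u ^ 2 ≠ 0 → ((Polynomial.C a * A + Polynomial.C b * B).eval u * (Polynomial.derivative (Polynomial.C a * B - Polynomial.C b * A)).eval u - (Polynomial.derivative (Polynomial.C a * A + Polynomial.C b * B)).eval u * (Polynomial.C a * B - Polynomial.C b * A).eval u) / ((Polynomial.C a * A + Polynomial.C b * B).eval u ^ 2 + (Polynomial.C a * B - Polynomial.C b * A).eval u ^ 2) = (A.eval u * (Polynomial.derivative B).eval u - (Polynomial.derivative A).eval u * B.eval u) / (A.eval u ^ 2 + B.eval u ^ 2) := by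
  intro A B a b u hab hAB
  rw [recentre_derivative, recentre_derivative', recentre_eval, recentre_eval', recentre_eval, recentre_eval']
  have hden : (a * A.eval u + b * B.eval u) ^ 2 + (a * B.eval u - b * A.eval u) ^ 2 =
      (a ^ 2 + b ^ 2) * (A.eval u ^ 2 + B.eval u ^ 2) := by ring
  rw [hden, div_eq_div_iff (mul_ne_zero hab hAB) hAB]
  ring

/-- The boundary leftover in half-angle form: `U W/(U² + W² y²) = τ/(1 + (τ y)²)`, `τ = W/U`, `U ≠ 0`. [folklore] -/
theorem leftover_eq_halfAngle {U W : ℝ} (hU : U ≠ 0) (y : ℝ) :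
    U * W / (U ^ 2 + W ^ 2 * y ^ 2) = (W / U) / (1 + (W / U * y) ^ 2) := by
  have h1 : U ^ 2 + W ^ 2 * y ^ 2 ≠ 0 := by positivity
  rw [div_eq_div_iff h1 (by positivity)]
  field_simp

/-- Off the grid `{k/N}`, a point of `[0,1]` lies in exactly one open piece `(k₀/N, (k₀+1)/N)`. [folklore] -/
theorem exists_unique_piece {N : ℕ} (hN : 1 ≤ N) {u : ℝ} (hu : u ∈ Set.Icc (0:ℝ) 1)
    (hgrid : ∀ k : ℕ, k ≤ N → u ≠ (k : ℝ) / N) :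
    ∃ k₀ : ℕ, k₀ < N ∧ ((k₀ : ℝ) / N < u ∧ u < ((k₀ : ℝ) + 1) / N) ∧
      ∀ k : ℕ, ((k : ℝ) / N < u ∧ u < ((k : ℝ) + 1) / N) → k = k₀ := by
  have hNpos : (0 : ℝ) < N := by exact_mod_cast hN
  have hu0 : 0 ≤ u * N := mul_nonneg hu.1 hNpos.le
  have hu1 : u < 1 := lt_of_le_of_ne hu.2 (fun h => hgrid N le_rfl (by rw [h, div_self hNpos.ne']))
  have hfl : ⌊u * N⌋₊ < N := by
    rw [Nat.floor_lt hu0]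
    calc u * N < 1 * N := mul_lt_mul_of_pos_right hu1 hNpos
      _ = N := one_mul _
  refine ⟨⌊u * N⌋₊, hfl, ⟨?_, ?_⟩, ?_⟩
  · have h1 : (⌊u * N⌋₊ : ℝ) ≤ u * N := Nat.floor_le hu0
    have h2 : (⌊u * N⌋₊ : ℝ) / N ≤ u := by rw [div_le_iff₀ hNpos]; exact h1
    exact lt_of_le_of_ne h2 (fun h => hgrid ⌊u * N⌋₊ hfl.le h.symm)
  · rw [lt_div_iff₀ hNpos]
    exact Nat.lt_floor_add_one (u * N)
  · rintro k ⟨hk1, hk2⟩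
    rw [div_lt_iff₀ hNpos] at hk1
    rw [lt_div_iff₀ hNpos] at hk2
    exact ((Nat.floor_eq_iff hu0).mpr ⟨hk1.le, hk2⟩).symm

end Summit.KontsevichZagierPeriods.KontsevichZagierPeriods.Cruxes.StokesGeneration.FibrewiseStokes

end
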